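/-
Origin: expansion seat `planner-pub-hodgecm-pv07-g5-0`, handover #8 2026-08-18T16:02Z (HANDOVER 16:01:56Z) (md5 978dd6df43f0cb5846ece575c2582eb0 (v2 16:06Z doc-only, SUPERSEDES 31965ffbf69c6440c13ca33b41541a2b); NEW additive leaf; ONE import rewrite by the generic ^import Pv[0-9]+g[0-9]+\. -> import HodgeCM.PerL34. rule: Pv07g5.GenuineSchrodingerSchwartzTensor (my #7, RUN 31); land AFTER my #6 and #7) (`HOME/pub-hodgecm-pv07-g5/lean/Pv07g5/GenuineSchrodingerSchwartzIso.lean`, md5 978dd6df, 259 lines);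
landed by the gen-8 packager in gate run 31 as `HodgeCM/PerL34/GenuineSchrodingerSchwartzIso.lean` (import ^import Pv07g5\.GenuineSchrodingerSchwartzTensor[ \t]*$→import HodgeCM.PerL34.GenuineSchrodingerSchwartzTensor ×1).
-/
/-
Copyright: HodgeCM publication cell (pub-hodgecm), DAG node N31 (seam S3, PerL v5 Lemma 4.2(b)) — the isometric
identification `⊗′ L²((L⁺_v)³; 1_{𝒪_v³}) → L²(X)` restricted to the Schwartz spaces is a linear ISOMETRIC ISOMORPHISM
`𝒮_⊗ ≅ 𝒮(X)`, equivariant; the S3 END along an equivariant isometric embedding of the algebraic restricted tensor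
product `𝒮_⊗` of the local Schwartz–Bruhat spaces.
Prover seat pub-hodgecm-pv07-g5 (DAG-node prover #07, generation 5), file #8 (HANDOVER #8).  Released under the
package licence.

Imports this seat's file #7 (`GenuineSchrodingerSchwartzTensor`; in the tree `HodgeCM.PerL34.GenuineSchrodingerSchwartzTensor`)
only.  Complete proofs, no new axioms, nothing cited, no hypothesis posited.
-/
import Summits.HodgeConjecture.HodgeCM.PerL34.GenuineSchrodingerSchwartzTensor

/-!
# `𝒮_⊗ ≅ 𝒮(X)` isometrically and equivariantly; the S3 END along an embedding of `𝒮_⊗`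

File #7 of this seat (`GenuineSchrodingerSchwartzTensor`) proved, inside pv13-g5's restricted Hilbert tensor product
`⊗′_{v split} (L²((L⁺_v)³), 1_{𝒪_v³})` (`RestrictedTensor.Space (locFam L)`), that the linear isometry
`tensorIso L : ⊗′ → L²(X)` (pv13-g5; onto by pv09-g7's `surjective_tensorIso`, not used here) carries the **algebraic restricted tensor product of the local Schwartz–Bruhat spaces**
`schwartzTensor L` (the span of the pure tensors `⊗ 1_{C_v}`, `C_v ⊆ (L⁺_v)³` compact open, `C_v = 𝒪_v³` for almost
all `v`) exactly ONTO the adelic Schwartz–Bruhat space `Coeff.schwartzBruhat L ⊂ L²(X)` (file #5), and that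
`schwartzTensor L` is stable under the tensor-product representation `repTensor L` (pv13-g5).  Here:

* §1 **`schwartzIso L : schwartzTensor L ≃ₗᵢ[ℂ] Coeff.schwartzBruhat L`** — the restriction of `tensorIso L`, a
  linear isometric isomorphism between the two (incomplete) inner product spaces, with
  `coe_schwartzIso_apply : ↑(schwartzIso L z) = tensorIso L ↑z`;
* §2 equivariance: `coe_schwartzIso_repTensor` (`schwartzIso ∘ repTensor(k) = rep L 1 k ∘ schwartzIso`),
  `coe_schwartzIso_symm_restrict` (for every twist `ν`: `schwartzIso⁻¹ (rep L ν k|_{𝒮(X)} v) = ν(k) • repTensor k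
  (schwartzIso⁻¹ v)`, using the tree's `rep_eq_smul_rep_one` and pv13-g5's `rep_tensorIso`), and the subtype form
  `schwartzIso_symm_restrict`;
* §3 **`Coeff.exists_compactDomain_thetaLift_ne_zero_genuine_tensorEmbed`**: file #5's END
  `…_genuine_schwartzEmbed` with `E := E_⊗ ∘ (schwartzIso L)⁻¹` — the S3 END for a doubling datum `D` on ANY space
  `Sp` fed through an isometric embedding `E_⊗ : schwartzTensor L →ₗᵢ[ℂ] Sp` of the ALGEBRAIC RESTRICTED TENSOR
  PRODUCT of the local Schwartz–Bruhat spaces, equivariant in the sense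
  `twistChar(χ)(k) • E_⊗ (repTensor k z) = D.ω k (E_⊗ z)` (the datum's torus action restricted to the image is the
  `χ`-twisted tensor product of the local split Schrödinger = dilation representations); conclusion for the vector
  `E_⊗ ((schwartzIso L)⁻¹ φ_e)`.

This is the LOCAL-TO-GLOBAL shape of the torus side of Lemma 4.2(b): a genuine global Weil-representation datum whose
space contains `⊗′_v 𝒮((L⁺_v)³)` place by place (as the restricted tensor product of the local Weil representations
restricted to the split torus does) meets the END through `E_⊗`, with no completeness and no global `L²` model asked
of it.  ABSOLUTE RULE respected: nothing cited; every hypothesis is data, a hypothesis of file #5's END passed through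
unchanged, or the equivariance equation `hE`.
-/

set_option linter.unusedSectionVars false
set_option autoImplicit false

noncomputable section

open MeasureTheory MeasureTheory.Measure Set Metric Function Complex ComplexConjugate Topology Filter
open scoped RestrictedProduct InnerProductSpace NNReal ENNReal TensorProduct Pointwise

namespace HodgeCM.PerL34.PureTensor

open HodgeCM.PerL34.SplitShells HodgeCM.PerL34.AdelicFactorisation HodgeCM.PerL34.RestrictedMeasure
open HodgeCM.PerL34.NoSmallSubgroups HodgeCM.PerL34.EulerFactorisation HodgeCM.PerL34.DiscreteFD
open HodgeCM.PerL34.LocalFactors HodgeCM.PerL34.LocalFactors.DilationModel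
open HodgeCM.PerL34.LocalModulus HodgeCM.PerL34.SplitPlaceDilation
open HodgeCM.PerL34.RallisIP HodgeCM.PerL34.Doubling HodgeCM.PerL34.N31d NumberField IsDedekindDomain
open HodgeCM.PerL34.IdelePlaces HodgeCM.PerL34.RestrictedRegroup HodgeCM.PerL34.RestrictedCutout
open HodgeCM.PerL34.IdelicTorusModel HodgeCM.PerL34.IdelicTorusModel.Genuine
open HodgeCM.PerL34.RestrictedTensor HodgeCM.PerL34.RestrictedTensor.ProdL2

attribute [local instance] LocalFactors.DilationModel.Adic.nontriviallyNormedField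
  LocalFactors.DilationModel.Adic.properSpace

namespace SchrodingerModel

section Iso

variable {L : Type} [Field L] [NumberField L] [IsCMField L]
  [∀ v : HeightOneSpectrum (𝓞 (maximalRealSubfield L)), MeasurableSpace (v.adicCompletion (maximalRealSubfield L))]
  [∀ v : HeightOneSpectrum (𝓞 (maximalRealSubfield L)), BorelSpace (v.adicCompletion (maximalRealSubfield L))]

/-! ## §1  `tensorIso` restricted: `𝒮_⊗ ≃ₗᵢ 𝒮(X)` -/

/-- `tensorIso L` restricted to `schwartzTensor L → Coeff.schwartzBruhat L`, as a linear map of the subtypes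
(well defined by file #7's `tensorIso_mem_schwartzBruhat_of_mem_schwartzTensor`). -/
def schwartzMap : schwartzTensor L →ₗ[ℂ] Coeff.schwartzBruhat L :=
  (tensorIso L).toLinearMap.restrict fun _ hz => tensorIso_mem_schwartzBruhat_of_mem_schwartzTensor hz

/-- (Ported verbatim from the HodgeCMPerL package; no docstring in the source.) -/
@[simp] theorem coe_schwartzMap_apply (z : schwartzTensor L) :
    ((schwartzMap z : Coeff.schwartzBruhat L) : Lp ℂ 2 (μ L)) = tensorIso L z := rfl

/-- (Ported verbatim from the HodgeCMPerL package; no docstring in the source.) -/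
theorem schwartzMap_injective : Function.Injective (schwartzMap (L := L)) := fun z w hzw =>
  Subtype.ext ((tensorIso L).injective (by
    simpa only [coe_schwartzMap_apply] using congrArg (Subtype.val : Coeff.schwartzBruhat L → Lp ℂ 2 (μ L)) hzw))

/-- surjectivity = file #7's `Coeff.schwartzBruhat_eq_map_schwartzTensor` (`𝒮(X) = tensorIso(𝒮_⊗)`). -/
theorem schwartzMap_surjective : Function.Surjective (schwartzMap (L := L)) := fun f => by
  have hf : (f : Lp ℂ 2 (μ L)) ∈ (schwartzTensor L).map (tensorIso L).toLinearMap := by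
    rw [← Coeff.schwartzBruhat_eq_map_schwartzTensor]
    exact f.2
  obtain ⟨z, hz, hzf⟩ := Submodule.mem_map.mp hf
  exact ⟨⟨z, hz⟩, Subtype.ext hzf⟩

variable (L) in
/-- **`𝒮_⊗ ≅ 𝒮(X)`**: the linear isometry `⊗′_{v split} L²((L⁺_v)³; 1_{𝒪_v³}) → L²(X)` (pv13-g5 `tensorIso`)
restricts to a linear isometric isomorphism of the algebraic restricted tensor product of the local Schwartz–Bruhat
spaces onto the adelic Schwartz–Bruhat space. -/
def schwartzIso : schwartzTensor L ≃ₗᵢ[ℂ] Coeff.schwartzBruhat L :=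
  { LinearEquiv.ofBijective schwartzMap ⟨schwartzMap_injective, schwartzMap_surjective⟩ with
    norm_map' := fun z => by
      change ‖(schwartzMap z : Coeff.schwartzBruhat L)‖ = ‖z‖
      rw [Submodule.coe_norm, Submodule.coe_norm, coe_schwartzMap_apply]
      exact (tensorIso L).norm_map _ }

/-- (Ported verbatim from the HodgeCMPerL package; no docstring in the source.) -/
@[simp] theorem coe_schwartzIso_apply (z : schwartzTensor L) :
    ((schwartzIso L z : Coeff.schwartzBruhat L) : Lp ℂ 2 (μ L)) = tensorIso L z := rfl

/-- `tensorIso (schwartzIso⁻¹ f) = f` -/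
@[simp] theorem tensorIso_coe_schwartzIso_symm (f : Coeff.schwartzBruhat L) :
    tensorIso L (((schwartzIso L).symm f : schwartzTensor L) : RestrictedTensor.Space (locFam L)) = f := by
  rw [← coe_schwartzIso_apply, LinearIsometryEquiv.apply_symm_apply]

/-- the range of `𝒮_⊗ ↪ ⊗′ → L²(X)` through `schwartzIso` is the Schwartz–Bruhat space (restated for convenience). -/
theorem range_subtype_comp_schwartzIso :
    Set.range (fun z : schwartzTensor L => ((schwartzIso L z : Coeff.schwartzBruhat L) : Lp ℂ 2 (μ L)))
      = (Coeff.schwartzBruhat L : Set (Lp ℂ 2 (μ L))) := by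
  ext f
  constructor
  · rintro ⟨z, rfl⟩
    exact (schwartzIso L z).2
  · intro hf
    exact ⟨(schwartzIso L).symm ⟨f, hf⟩, by simp only [LinearIsometryEquiv.apply_symm_apply]⟩

/-! ## §2  Equivariance -/

section Equivariance

variable [DecidableEq (Place (maximalRealSubfield L))]

/-- **`schwartzIso ∘ repTensor(k) = rep L 1 k ∘ schwartzIso`** on `𝒮_⊗` (pv13-g5 `rep_tensorIso`; file #7
`repTensor_mem_schwartzTensor` makes the left-hand side an element of `𝒮_⊗`). -/
theorem coe_schwartzIso_repTensor (k : Model L) (z : schwartzTensor L) :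
    ((schwartzIso L ⟨repTensor L k z, repTensor_mem_schwartzTensor k z.2⟩ : Coeff.schwartzBruhat L) : Lp ℂ 2 (μ L))
      = rep L 1 k ((schwartzIso L z : Coeff.schwartzBruhat L) : Lp ℂ 2 (μ L)) := by
  rw [coe_schwartzIso_apply, coe_schwartzIso_apply, rep_tensorIso]

/-- twisted form: `rep L ν k (schwartzIso z) = ν(k) • schwartzIso (repTensor k z)` (the twist is a scalar: tree
`rep_eq_smul_rep_one`). -/
theorem rep_coe_schwartzIso (ν : Model L →* Circle) (k : Model L) (z : schwartzTensor L) :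
    rep L ν k ((schwartzIso L z : Coeff.schwartzBruhat L) : Lp ℂ 2 (μ L))
      = ((ν k : Circle) : ℂ) • ((schwartzIso L ⟨repTensor L k z, repTensor_mem_schwartzTensor k z.2⟩ :
          Coeff.schwartzBruhat L) : Lp ℂ 2 (μ L)) := by
  rw [Coeff.rep_eq_smul_rep_one, coe_schwartzIso_repTensor]

/-- **`schwartzIso⁻¹` intertwines the restricted twisted dilation representation with the twisted tensor-product
representation**: `schwartzIso⁻¹ (rep L ν k|_{𝒮(X)} v) = ν(k) • repTensor k (schwartzIso⁻¹ v)` in `⊗′`. -/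
theorem coe_schwartzIso_symm_restrict (ν : Model L →* Circle) (k : Model L) (v : Coeff.schwartzBruhat L) :
    (((schwartzIso L).symm (Transfer.restrict (rep L ν) _ (Coeff.schwartzBruhat_stable ν) k v) : schwartzTensor L) :
        RestrictedTensor.Space (locFam L))
      = ((ν k : Circle) : ℂ) • repTensor L k (((schwartzIso L).symm v : schwartzTensor L) :
          RestrictedTensor.Space (locFam L)) := by
  apply (tensorIso L).injective
  rw [tensorIso_coe_schwartzIso_symm, Transfer.coe_restrict_apply, map_smul, ← rep_tensorIso,
    tensorIso_coe_schwartzIso_symm, Coeff.rep_eq_smul_rep_one]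

/-- the same in the subtype `schwartzTensor L`. -/
theorem schwartzIso_symm_restrict (ν : Model L →* Circle) (k : Model L) (v : Coeff.schwartzBruhat L) :
    (schwartzIso L).symm (Transfer.restrict (rep L ν) _ (Coeff.schwartzBruhat_stable ν) k v)
      = ((ν k : Circle) : ℂ) • (⟨repTensor L k (((schwartzIso L).symm v : schwartzTensor L) :
          RestrictedTensor.Space (locFam L)), repTensor_mem_schwartzTensor k ((schwartzIso L).symm v).2⟩ :
            schwartzTensor L) :=
  Subtype.ext (by
    change _ = ((ν k : Circle) : ℂ) •
      repTensor L k (((schwartzIso L).symm v : schwartzTensor L) : RestrictedTensor.Space (locFam L))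
    exact coe_schwartzIso_symm_restrict ν k v)

end Equivariance

end Iso

/-! ## §3  The S3 END along an embedding of `𝒮_⊗` -/

namespace Coeff

section tensorEmbed

variable (L : Type) [Field L] [NumberField L] [IsCMField L]

-- (no `L⁺` notation inside `variable` binders: a `notation3` token there does not re-elaborate)
variable [DecidableEq (Place (maximalRealSubfield L))]
    [∀ v : HeightOneSpectrum (𝓞 (maximalRealSubfield L)), MeasurableSpace (v.adicCompletion (maximalRealSubfield L))]
    [∀ v : HeightOneSpectrum (𝓞 (maximalRealSubfield L)), BorelSpace (v.adicCompletion (maximalRealSubfield L))]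
    (S₀ : Finset (Place (maximalRealSubfield L)))
    {Sp : Type} [NormedAddCommGroup Sp] [InnerProductSpace ℂ Sp]
    {W : Type} [AddCommGroup W] [Module L W]
    {H Sbox : Type} [Group H] [AddCommGroup Sbox] [Module ℂ Sbox]
    {h : W →ₗ⋆[L] W →ₗ[L] L} (hW : IsLine L W) (hh : Anisotropic h)
    (D : DoublingDatum (Model L) H Sp Sbox) (GU : ThetaSide Sp Sbox)
    (j : isomBox h →* H) (hj : ∀ d : unitary L, j ⟨iotaSnd d, iotaSnd_mem h d⟩ = D.ι (1, unitaryToModel L d))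
    (χ : Model L →* Circle) (hχΓ : ∀ d : unitary L, χ (unitaryToModel L d) = 1)
    (hχVΓ : ∀ d : unitary L, D.χV (unitaryToModel L d) = 1)
    {hP : ∀ Ψ : Sbox, ∀ p ∈ (stabDelta L W).subgroupOf (isomBox h), ∀ x : H, D.fSW Ψ (j p * x) = D.fSW Ψ x}
    (P : GluePrintInputs D GU h j hP)
    (hloc : ∀ (i : Place (maximalRealSubfield L)) (v : Sp),
      Continuous fun g : locTorus (maximalRealSubfield L) L i => D.ω (RestrictedProduct.mulSingle (genLevel L) i g) v)
    {T' : Finset (Place (maximalRealSubfield L))} (hχT' : RestrictedProduct.boxSubgroup (genLevel L) T' ≤ χ.ker)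
    (hlocχ : ∀ i ∈ T', Continuous fun g : locTorus (maximalRealSubfield L) L i =>
      χ (RestrictedProduct.mulSingle (genLevel L) i g))
    {S : Finset (Place (maximalRealSubfield L))} (hT'S : T' ⊆ S)
    (hS : ∀ v : InfinitePlace (maximalRealSubfield L), Sum.inl v ∈ S)

include hW hh hj hχΓ hχVΓ P hloc hT'S hS

set_option synthInstance.maxHeartbeats 200000 in
-- (as in the END theorem: the `SMul Γ (Model L)` instance behind `IsFundamentalDomain` is slow to find)
/-- **S3 END, torus side by the genuine split Schrödinger model ALONG AN EMBEDDING OF THE RESTRICTED TENSOR PRODUCT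
OF THE LOCAL SCHWARTZ–BRUHAT SPACES.**  For a doubling datum `D` on ANY space `Sp` (+ theta side, print inputs,
`hloc`, the `χ`-side level data — unchanged from file #5) and an isometric embedding
`E : schwartzTensor L →ₗᵢ[ℂ] Sp` of `𝒮_⊗ = ⊗′_{v split} 𝒮((L⁺_v)³)` (algebraic restricted tensor product w.r.t. the
vectors `1_{𝒪_v³}`) such that `twistChar(χ)(k) • E (repTensor k z) = D.ω k (E z)` — i.e. `D.ω` restricted to the image
is the `χ`-twisted restricted tensor product of the local split Schrödinger (dilation) representations — the END's
conclusion holds for the vector `E ((schwartzIso L)⁻¹ φ_e)`, `φ_e = phiE (shiftFor S χ hχT' hlocχ)`.  Proof: file #5's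
`…_genuine_schwartzEmbed` for `E ∘ (schwartzIso L)⁻¹`, equivariant by `schwartzIso_symm_restrict`. -/
theorem exists_compactDomain_thetaLift_ne_zero_genuine_tensorEmbed
    (E : schwartzTensor L →ₗᵢ[ℂ] Sp)
    (hE : ∀ (g : Model L) (z : schwartzTensor L),
      ((twistChar L χ g : Circle) : ℂ) •
          E ⟨repTensor L g (z : RestrictedTensor.Space (locFam L)), repTensor_mem_schwartzTensor g z.2⟩
        = D.ω g (E z))
    [IsFiniteMeasure GU.μ] :
    ∃ 𝓕 : Set (Model L), IsCompact 𝓕 ∧ (interior 𝓕).Nonempty ∧ MeasurableSet 𝓕 ∧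
      IsFundamentalDomain (unitaryToModel L).range 𝓕
        (haarDatum (genLevel L) (isCompact_genLevel L) (isOpen_genLevel L) S₀).μ ∧
      (haarDatum (genLevel L) (isCompact_genLevel L) (isOpen_genLevel L) S₀).μ 𝓕 ≠ 0 ∧
      (haarDatum (genLevel L) (isCompact_genLevel L) (isOpen_genLevel L) S₀).μ 𝓕 ≠ ⊤ ∧
      ∀ [IsFiniteMeasure (((haarDatum (genLevel L) (isCompact_genLevel L) (isOpen_genLevel L) S₀).μ).restrict 𝓕)]
        (hk : Measurable (Function.uncurry (thetaFn D GU
          (E ((schwartzIso L).symm ⟨phiE (shiftFor S χ hχT' hlocχ), phiE_mem_schwartzBruhat _⟩))))) {Ck : ℝ}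
        (hCk : 0 ≤ Ck) (hkC : ∀ q u, ‖thetaFn D GU
          (E ((schwartzIso L).symm ⟨phiE (shiftFor S χ hχT' hlocχ), phiE_mem_schwartzBruhat _⟩)) q u‖ ≤ Ck),
        PeterssonFubini.theta GU.μ
          (((haarDatum (genLevel L) (isCompact_genLevel L) (isOpen_genLevel L) S₀).μ).restrict 𝓕) hk
          (measurable_coe_char (genLevel L) (isOpen_genLevel L) χ hχT' hlocχ) hCk hkC (norm_coe_char_le χ) ≠ 0 := by
  have hE' : ∀ (g : Model L) (v : schwartzBruhat L),
      (E.comp (schwartzIso L).symm.toLinearIsometry)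
          (Transfer.restrict (rep L (twistChar L χ)) _ (schwartzBruhat_stable (twistChar L χ)) g v)
        = D.ω g ((E.comp (schwartzIso L).symm.toLinearIsometry) v) := fun g v => by
    have h1 := schwartzIso_symm_restrict (twistChar L χ) g v
    have h2 := hE g ((schwartzIso L).symm v)
    -- (`simp only`, not `rw`: keyed matching at reducible transparency, so the near-miss candidate
    -- `restrict g v =?= v` is not unfolded through `dilationRep`)
    simp only [LinearIsometry.coe_comp, Function.comp_apply, LinearIsometryEquiv.coe_toLinearIsometry, h1,
      LinearIsometry.map_smul, h2]
  exact exists_compactDomain_thetaLift_ne_zero_genuine_schwartzEmbed L S₀ hW hh D GU j hj χ hχΓ hχVΓ P hloc hχT' hlocχ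
    hT'S hS (E.comp (schwartzIso L).symm.toLinearIsometry) hE'

end tensorEmbed

end Coeff

end SchrodingerModel

end HodgeCM.PerL34.PureTensor

end
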